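import Mathlib
import Summits.Ventures.PercRepro2.Defs
import Summits.Ventures.PercRepro2.Harris
import Summits.Ventures.PercRepro2.Independence
import Summits.Ventures.PercRepro2.CoinDefs
import Summits.Ventures.PercRepro2.CoinReverse
import Summits.Ventures.PercRepro2.CoinStarDefs
import Summits.Ventures.PercRepro2.CoinLsmCoreDefs
import Summits.Ventures.PercRepro2.CoinLsmCoreU
import Summits.Ventures.PercRepro2.CoinCoreGate
import Summits.Ventures.PercRepro2.CoinOrTailAlg
import Summits.Ventures.PercRepro2.CoinOrTailDefs
import Summits.Ventures.PercRepro2.CoinOrTailLsmDefs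
import Summits.Ventures.PercRepro2.CoinOrTailLsmSums
import Summits.Ventures.PercRepro2.CoinOrTailBlockAlg
import Summits.Ventures.PercRepro2.CoinOrTailBlockSums
import Summits.Ventures.PercRepro2.CoinOrTailMixLsm
import Summits.Ventures.PercRepro2.CoinBlockTheoremII
import Summits.Ventures.PercRepro2.CoinBlockMeanOrder
import Summits.Ventures.PercRepro2.CoinLsmCoreSure
import Summits.Ventures.PercRepro2.CoinMixBlock
import Summits.Ventures.PercRepro2.CoinOrTailKDefs
import Summits.Ventures.PercRepro2.CoinOrTailKSums
import Summits.Ventures.PercRepro2.CoinOrTailKAlg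
import Summits.Ventures.PercRepro2.CoinOrTailCovCore
import Summits.Ventures.PercRepro2.CoinOrTailKCore
import Summits.Ventures.PercRepro2.CoinK2HeadBlindBlock
import Summits.Ventures.PercRepro2.CoinK2HeadBlindBlock2
import Summits.Ventures.PercRepro2.CoinK2HeadBlindVals
import Summits.Ventures.PercRepro2.CoinK2HeadBlindSums

/-!
# Row 2′DARC at an OR-tail with TWO INCOMPARABLE UNCOVERED entries — the head-blind case
(blind cell PercRepro2, night-2 g12; proofs/NIGHT2-DARC.md §47)

`OrTailK arcs s U ent c a` with `ent = {r₁, r₂}` and SURE tail coins (`p(c r) = 1`), ANY two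
markers `m₁, m₂ ∈ U` — no covering hypothesis at all — under the HEAD-BLIND hypothesis: the head
value of a cluster depends on the cluster only through its entry trace `W ∩ ent` («the core talks
to the head only through the tail's entries»), and the mild non-degeneracy «nothing in
`ent ∪ {a, w}` reaches `t` with positive probability».  Conclusion: `DARC pr arcs s {t} m₁ m₂ a w`
— row 2′DARC at `a → w` for every probability vector.

With sure coins the tail weight is the indicator «no entry present», so the `R`-value of a cluster
is `A W = A ∅` on the entry-free clusters and `A (W ∩ ent ∪ {a})` on the others: the marker-block
sums split into the four ENTRY STATES (`sum_split_four` applied with the two entries as «markers»),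
the `R`-law being `a + α₁n₁ + α₂n₂ + α₁₂n₁₂` and the gate `a + β₁n₁ + β₂n₂ + β₁₂n₁₂` with the six
head values of the states; the block theorem `k2HeadBlind_block_nonneg'` closes, its sublattice
hypotheses being the Ahlswede–Daykin steps `cellBlock_mul_le` on the principal-filter pieces
`[r₁]`, `[r₂]`, `[r₁r₂]` and the principal-ideal piece `{r₁, r₂ ∉ W}` of the log-supermodular
`R`-weight `ν · rValK`, and the marker-mean orderings `holleyBlock_D_nonneg`.
-/

namespace Summit.Ventures.PercRepro2.Coin

open Classical

section K2Functional

variable {V : Type*} {E : Type*} [Fintype V] [DecidableEq V] {R : Type*} [Field R] [LinearOrder R]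
  [IsStrictOrderedRing R]

/-- **THE HEAD-BLIND TWO-ENTRY OR-TAIL FUNCTIONAL IS NONNEGATIVE** (no covering hypothesis):
`ent = {r₁, r₂}` with sure coins, the cluster law `ν` log-supermodular, the head `A` nonnegative,
decreasing, log-supermodular and BLIND to everything but the entry trace, nothing in
`ent ∪ {a, w}` surely reaching the target. -/
theorem orTailK2HeadBlind_functional_nonneg (U : Finset V) (ν A : Finset V → R) (pr : E → R)
    (ent : Finset V) (c : V → E) (r₁ r₂ m₁ m₂ a w : V)
    (hp0 : ∀ e, 0 ≤ pr e) (hp1 : ∀ e, pr e ≤ 1) (hsure : ∀ r ∈ ent, pr (c r) = 1)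
    (hr₁ : r₁ ∈ ent) (hr₂ : r₂ ∈ ent) (hent : ∀ r ∈ ent, r = r₁ ∨ r = r₂)
    (hw : w ∉ ent) (haw : a ≠ w)
    (hν0 : ∀ W, 0 ≤ ν W) (hν : ∀ s ⊆ U, ∀ t ⊆ U, ν s * ν t ≤ ν (s ∩ t) * ν (s ∪ t))
    (hA0 : ∀ W, 0 ≤ A W) (hA : ∀ s t : Finset V, A s * A t ≤ A (s ∩ t) * A (s ∪ t))
    (hmono : ∀ s t : Finset V, s ⊆ t → A t ≤ A s)
    (hblind : ∀ W ⊆ U, ∀ X ⊆ ({a, w} : Finset V), A (W ∪ X) = A (W ∩ ent ∪ X))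
    (hpos : 0 < A (ent ∪ {a, w})) :
    0 ≤ (∑ W ∈ U.powerset, ν W * rValK A pr ent c a W) ^ 2 *
          (∑ W ∈ U.powerset, ν W * gValK A pr ent c a w W *
            ((if m₁ ∈ W then (1 : R) else 0) * (if m₂ ∈ W then (1 : R) else 0)))
        - (∑ W ∈ U.powerset, ν W * rValK A pr ent c a W) *
          (∑ W ∈ U.powerset, ν W * rValK A pr ent c a W * (if m₁ ∈ W then (1 : R) else 0)) *
          (∑ W ∈ U.powerset, ν W * gValK A pr ent c a w W * (if m₂ ∈ W then (1 : R) else 0))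
        - (∑ W ∈ U.powerset, ν W * rValK A pr ent c a W) *
          (∑ W ∈ U.powerset, ν W * rValK A pr ent c a W * (if m₂ ∈ W then (1 : R) else 0)) *
          (∑ W ∈ U.powerset, ν W * gValK A pr ent c a w W * (if m₁ ∈ W then (1 : R) else 0))
        + (∑ W ∈ U.powerset, ν W * rValK A pr ent c a W * (if m₁ ∈ W then (1 : R) else 0)) *
          (∑ W ∈ U.powerset, ν W * rValK A pr ent c a W * (if m₂ ∈ W then (1 : R) else 0)) *
          (∑ W ∈ U.powerset, ν W * gValK A pr ent c a w W) := by
  have hr0 : ∀ W, 0 ≤ rValK A pr ent c a W := fun W => rValK_nonneg hp0 hp1 hA0 ent c a W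
  -- the `R`-weight
  set G : Finset V → R := fun W => ν W * rValK A pr ent c a W with hGdef
  have hG0 : ∀ W, 0 ≤ G W := fun W => mul_nonneg (hν0 W) (hr0 W)
  have hG : ∀ s' ⊆ U, ∀ t' ⊆ U, G s' * G t' ≤ G (s' ∩ t') * G (s' ∪ t') := by
    intro s' hs' t' ht'
    simp only [hGdef]
    calc ν s' * rValK A pr ent c a s' * (ν t' * rValK A pr ent c a t')
        = (ν s' * ν t') * (rValK A pr ent c a s' * rValK A pr ent c a t') := by ring
      _ ≤ (ν (s' ∩ t') * ν (s' ∪ t')) *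
            (rValK A pr ent c a (s' ∩ t') * rValK A pr ent c a (s' ∪ t')) :=
          mul_le_mul (hν s' hs' t' ht') (rValK_mul_le_all A pr ent c a hp0 hp1 hA0 hA hmono s' t')
            (mul_nonneg (hr0 _) (hr0 _)) (mul_nonneg (hν0 _) (hν0 _))
      _ = ν (s' ∩ t') * rValK A pr ent c a (s' ∩ t') *
            (ν (s' ∪ t') * rValK A pr ent c a (s' ∪ t')) := by ring
  -- the four sublattice pieces
  have hFa := gateF_nonneg_of_below U G (fun W => G W * cellWt r₁ r₂ false false W) m₁ m₂ hG0
    (fun W => mul_nonneg (hG0 W) (cellWt_nonneg _ _ _ _ _)) (ideal_lsm U G r₁ r₂ hG0 hG)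
    (ideal_below U G r₁ r₂ hG0 hG)
  have hFd := gateF_nonneg_of_above U G (fun W => G W * cellWt r₁ r₂ true true W) m₁ m₂ hG0
    (fun W => mul_nonneg (hG0 W) (cellWt_nonneg _ _ _ _ _)) hG (top_lsm U G r₁ r₂ hG0 hG)
    (top_above U G r₁ r₂ hG0 hG)
  have hF1 := gateF_nonneg_of_above U G (fun W => G W * mWt r₁ true W) m₁ m₂ hG0
    (fun W => mul_nonneg (hG0 W) (mWt_nonneg _ _ _)) hG (filter_lsm U G r₁ hG0 hG)
    (filter_above U G r₁ hG0 hG)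
  have hF2 := gateF_nonneg_of_above U G (fun W => G W * mWt r₂ true W) m₁ m₂ hG0
    (fun W => mul_nonneg (hG0 W) (mWt_nonneg _ _ _)) hG (filter_lsm U G r₂ hG0 hG)
    (filter_above U G r₂ hG0 hG)
  -- the block sums: the covered piece and the three unweighted entry-state masses
  set aa : Bool → Bool → R := fun b₁ b₂ =>
    ∑ W ∈ U.powerset, ν W * rValK A pr ent c a W * cellWt m₁ m₂ b₁ b₂ W *
      cellWt r₁ r₂ false false W with haadef
  set n : Bool → Bool → Bool → Bool → R := fun e₁ e₂ b₁ b₂ =>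
    ∑ W ∈ U.powerset, ν W * cellWt r₁ r₂ e₁ e₂ W * cellWt m₁ m₂ b₁ b₂ W with hndef
  have haa0 : ∀ b₁ b₂, 0 ≤ aa b₁ b₂ := fun b₁ b₂ => Finset.sum_nonneg fun W _ =>
    mul_nonneg (mul_nonneg (mul_nonneg (hν0 W) (hr0 W)) (cellWt_nonneg _ _ _ _ _))
      (cellWt_nonneg _ _ _ _ _)
  have hn0 : ∀ e₁ e₂ b₁ b₂, 0 ≤ n e₁ e₂ b₁ b₂ := fun e₁ e₂ b₁ b₂ => Finset.sum_nonneg fun W _ =>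
    mul_nonneg (mul_nonneg (hν0 W) (cellWt_nonneg _ _ _ _ _)) (cellWt_nonneg _ _ _ _ _)
  -- the decompositions of the marker-block sums
  have hL : ∀ b₁ b₂, (∑ W ∈ U.powerset, G W * cellWt m₁ m₂ b₁ b₂ W) =
      aa b₁ b₂ + A ({r₁} ∪ {a}) * n true false b₁ b₂ + A ({r₂} ∪ {a}) * n false true b₁ b₂ +
        A (ent ∪ {a}) * n true true b₁ b₂ := fun b₁ b₂ =>
    R_blocks_eq U ν A pr ent c r₁ r₂ m₁ m₂ a w hsure hr₁ hr₂ hent hblind b₁ b₂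
  have hM : ∀ b₁ b₂, (∑ W ∈ U.powerset, ν W * gValK A pr ent c a w W * cellWt m₁ m₂ b₁ b₂ W) =
      aa b₁ b₂ + A ({r₁} ∪ {a, w}) * n true false b₁ b₂ + A ({r₂} ∪ {a, w}) * n false true b₁ b₂ +
        A (ent ∪ {a, w}) * n true true b₁ b₂ := fun b₁ b₂ =>
    G_blocks_eq U ν A pr ent c r₁ r₂ m₁ m₂ a w hsure hr₁ hr₂ hent hblind b₁ b₂
  -- the pieces' block sums in the `a / n` form
  have sFa : ∀ b₁ b₂, (∑ W ∈ U.powerset, G W * cellWt r₁ r₂ false false W * cellWt m₁ m₂ b₁ b₂ W) =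
      aa b₁ b₂ := by
    intro b₁ b₂
    simp only [haadef, hGdef]
    exact Finset.sum_congr rfl fun W _ => by ring
  have sFd : ∀ b₁ b₂, (∑ W ∈ U.powerset, G W * cellWt r₁ r₂ true true W * cellWt m₁ m₂ b₁ b₂ W) =
      A (ent ∪ {a}) * n true true b₁ b₂ := by
    intro b₁ b₂
    have e := state_sum_eq U ν (A (ent ∪ {a})) r₁ r₂ m₁ m₂ true true b₁ b₂ G
      (rval_cell_tt U ν A pr ent c r₁ r₂ a w hsure hr₁ hent hblind)
    rw [← e]
    exact Finset.sum_congr rfl fun W _ => by ring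
  have sF1 : ∀ b₁ b₂, (∑ W ∈ U.powerset, G W * mWt r₁ true W * cellWt m₁ m₂ b₁ b₂ W) =
      A ({r₁} ∪ {a}) * n true false b₁ b₂ + A (ent ∪ {a}) * n true true b₁ b₂ := by
    intro b₁ b₂
    have e1 := state_sum_eq U ν (A ({r₁} ∪ {a})) r₁ r₂ m₁ m₂ true false b₁ b₂ G
      (rval_cell_tf U ν A pr ent c r₁ r₂ a w hsure hr₁ hent hblind)
    have e2 := state_sum_eq U ν (A (ent ∪ {a})) r₁ r₂ m₁ m₂ true true b₁ b₂ G
      (rval_cell_tt U ν A pr ent c r₁ r₂ a w hsure hr₁ hent hblind)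
    rw [← e1, ← e2, ← Finset.sum_add_distrib]
    refine Finset.sum_congr rfl fun W _ => ?_
    rw [mWt_true_eq_cell_sum r₁ r₂ W]; ring
  have sF2 : ∀ b₁ b₂, (∑ W ∈ U.powerset, G W * mWt r₂ true W * cellWt m₁ m₂ b₁ b₂ W) =
      A ({r₂} ∪ {a}) * n false true b₁ b₂ + A (ent ∪ {a}) * n true true b₁ b₂ := by
    intro b₁ b₂
    have e1 := state_sum_eq U ν (A ({r₂} ∪ {a})) r₁ r₂ m₁ m₂ false true b₁ b₂ G
      (rval_cell_ft U ν A pr ent c r₁ r₂ a w hsure hr₂ hent hblind)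
    have e2 := state_sum_eq U ν (A (ent ∪ {a})) r₁ r₂ m₁ m₂ true true b₁ b₂ G
      (rval_cell_tt U ν A pr ent c r₁ r₂ a w hsure hr₁ hent hblind)
    rw [← e1, ← e2, ← Finset.sum_add_distrib]
    refine Finset.sum_congr rfl fun W _ => ?_
    rw [mWt_true_eq_cell_sum' r₁ r₂ W]; ring
  -- `H1`: the `R`-law is log-supermodular at block level
  have H1 : (∑ W ∈ U.powerset, G W * cellWt m₁ m₂ true false W) *
      (∑ W ∈ U.powerset, G W * cellWt m₁ m₂ false true W) ≤
      (∑ W ∈ U.powerset, G W * cellWt m₁ m₂ false false W) *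
      (∑ W ∈ U.powerset, G W * cellWt m₁ m₂ true true W) := by
    have := cellBlock_mul_le U G G G G m₁ m₂ true false false true hG0 hG0 hG0 hG0 hG
    simpa only [Bool.true_and, Bool.and_true, Bool.false_or, Bool.or_false] using this
  -- the value hypotheses
  have sub1 : ({r₁} ∪ {a} : Finset V) ⊆ ent ∪ {a, w} := by
    intro x hx
    simp only [Finset.mem_union, Finset.mem_singleton] at hx
    simp only [Finset.mem_union, Finset.mem_insert, Finset.mem_singleton]
    rcases hx with rfl | rfl
    · exact Or.inl hr₁
    · exact Or.inr (Or.inl rfl)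
  have sub2 : ({r₂} ∪ {a} : Finset V) ⊆ ent ∪ {a, w} := by
    intro x hx
    simp only [Finset.mem_union, Finset.mem_singleton] at hx
    simp only [Finset.mem_union, Finset.mem_insert, Finset.mem_singleton]
    rcases hx with rfl | rfl
    · exact Or.inl hr₂
    · exact Or.inr (Or.inl rfl)
  have sub12 : (ent ∪ {a} : Finset V) ⊆ ent ∪ {a, w} := by
    intro x hx
    simp only [Finset.mem_union, Finset.mem_singleton] at hx
    simp only [Finset.mem_union, Finset.mem_insert, Finset.mem_singleton]
    rcases hx with h | rfl
    · exact Or.inl h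
    · exact Or.inr (Or.inl rfl)
  have hα₁ : 0 < A ({r₁} ∪ {a}) := lt_of_lt_of_le hpos (hmono _ _ sub1)
  have hα₂ : 0 < A ({r₂} ∪ {a}) := lt_of_lt_of_le hpos (hmono _ _ sub2)
  have hα₁₂ : 0 < A (ent ∪ {a}) := lt_of_lt_of_le hpos (hmono _ _ sub12)
  have hβ₁₂ : A (ent ∪ {a, w}) ≤ A (ent ∪ {a}) := hmono _ _ sub12
  -- the ratio conditions: one lattice step of the head each
  have inter1 : ({r₁} ∪ {a, w} : Finset V) ∩ (ent ∪ {a}) = {r₁} ∪ {a} := by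
    ext x
    simp only [Finset.mem_inter, Finset.mem_union, Finset.mem_insert, Finset.mem_singleton]
    constructor
    · rintro ⟨h1, h2⟩
      rcases h1 with rfl | rfl | rfl
      · exact Or.inl rfl
      · exact Or.inr rfl
      · rcases h2 with h2 | h2
        · exact absurd h2 hw
        · exact absurd h2 haw.symm
    · rintro (rfl | rfl)
      · exact ⟨Or.inl rfl, Or.inl hr₁⟩
      · exact ⟨Or.inr (Or.inl rfl), Or.inr rfl⟩
  have union1 : ({r₁} ∪ {a, w} : Finset V) ∪ (ent ∪ {a}) = ent ∪ {a, w} := by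
    ext x
    simp only [Finset.mem_union, Finset.mem_insert, Finset.mem_singleton]
    constructor
    · rintro ((rfl | rfl | rfl) | (h | rfl))
      · exact Or.inl hr₁
      · exact Or.inr (Or.inl rfl)
      · exact Or.inr (Or.inr rfl)
      · exact Or.inl h
      · exact Or.inr (Or.inl rfl)
    · rintro (h | rfl | rfl)
      · exact Or.inr (Or.inl h)
      · exact Or.inl (Or.inr (Or.inl rfl))
      · exact Or.inl (Or.inr (Or.inr rfl))
  have inter2 : ({r₂} ∪ {a, w} : Finset V) ∩ (ent ∪ {a}) = {r₂} ∪ {a} := by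
    ext x
    simp only [Finset.mem_inter, Finset.mem_union, Finset.mem_insert, Finset.mem_singleton]
    constructor
    · rintro ⟨h1, h2⟩
      rcases h1 with rfl | rfl | rfl
      · exact Or.inl rfl
      · exact Or.inr rfl
      · rcases h2 with h2 | h2
        · exact absurd h2 hw
        · exact absurd h2 haw.symm
    · rintro (rfl | rfl)
      · exact ⟨Or.inl rfl, Or.inl hr₂⟩
      · exact ⟨Or.inr (Or.inl rfl), Or.inr rfl⟩
  have union2 : ({r₂} ∪ {a, w} : Finset V) ∪ (ent ∪ {a}) = ent ∪ {a, w} := by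
    ext x
    simp only [Finset.mem_union, Finset.mem_insert, Finset.mem_singleton]
    constructor
    · rintro ((rfl | rfl | rfl) | (h | rfl))
      · exact Or.inl hr₂
      · exact Or.inr (Or.inl rfl)
      · exact Or.inr (Or.inr rfl)
      · exact Or.inl h
      · exact Or.inr (Or.inl rfl)
    · rintro (h | rfl | rfl)
      · exact Or.inr (Or.inl h)
      · exact Or.inl (Or.inr (Or.inl rfl))
      · exact Or.inl (Or.inr (Or.inr rfl))
  have hrat₁ : A ({r₁} ∪ {a, w}) * A (ent ∪ {a}) ≤ A (ent ∪ {a, w}) * A ({r₁} ∪ {a}) := by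
    have := hA ({r₁} ∪ {a, w}) (ent ∪ {a})
    rw [inter1, union1] at this
    linarith
  have hrat₂ : A ({r₂} ∪ {a, w}) * A (ent ∪ {a}) ≤ A (ent ∪ {a, w}) * A ({r₂} ∪ {a}) := by
    have := hA ({r₂} ∪ {a, w}) (ent ∪ {a})
    rw [inter2, union2] at this
    linarith
  -- the marker split of the goal
  have eΛ := sum_split_four U (fun W => ν W * rValK A pr ent c a W) m₁ m₂
  have eF1 := sum_split_fst U (fun W => ν W * rValK A pr ent c a W) m₁ m₂
  have eF2 := sum_split_snd U (fun W => ν W * rValK A pr ent c a W) m₁ m₂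
  have eM := sum_split_four U (fun W => ν W * gValK A pr ent c a w W) m₁ m₂
  have eX := sum_split_fst U (fun W => ν W * gValK A pr ent c a w W) m₁ m₂
  have eY := sum_split_snd U (fun W => ν W * gValK A pr ent c a w W) m₁ m₂
  have eXY := sum_split_both U (fun W => ν W * gValK A pr ent c a w W) m₁ m₂
  rw [eΛ, eF1, eF2, eM, eX, eY, eXY]
  -- the block theorem
  have key := k2HeadBlind_block_nonneg' (aa false false) (aa false true) (aa true false)
    (aa true true) (n true false false false) (n true false false true) (n true false true false)
    (n true false true true) (n false true false false) (n false true false true)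
    (n false true true false) (n false true true true) (n true true false false)
    (n true true false true) (n true true true false) (n true true true true)
    (A ({r₁} ∪ {a})) (A ({r₂} ∪ {a})) (A (ent ∪ {a})) (A ({r₁} ∪ {a, w})) (A ({r₂} ∪ {a, w}))
    (A (ent ∪ {a, w}))
    (haa0 _ _) (haa0 _ _) (haa0 _ _) (haa0 _ _) (hn0 _ _ _ _) (hn0 _ _ _ _) (hn0 _ _ _ _)
    (hn0 _ _ _ _) (hn0 _ _ _ _) (hn0 _ _ _ _) (hn0 _ _ _ _) (hn0 _ _ _ _) (hn0 _ _ _ _)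
    (hn0 _ _ _ _) (hn0 _ _ _ _) (hn0 _ _ _ _) hα₁ hα₂ hα₁₂ (hA0 _) (hA0 _) (hA0 _) hβ₁₂ hrat₁ hrat₂
    (by rw [← hL, ← hL, ← hL, ← hL]; exact H1)
    (by rw [← hL, ← hL, ← hL, ← hL, ← sFa, ← sFa, ← sFa, ← sFa]; exact hFa)
    (by rw [← hL, ← hL, ← hL, ← hL, ← sFd, ← sFd, ← sFd, ← sFd]; exact hFd)
    (by rw [← hL, ← hL, ← hL, ← hL, ← sF1, ← sF1, ← sF1, ← sF1]; exact hF1)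
    (by rw [← hL, ← hL, ← hL, ← hL, ← sF2, ← sF2, ← sF2, ← sF2]; exact hF2)
  rw [← hL, ← hL, ← hL, ← hL, ← hM, ← hM, ← hM, ← hM] at key
  unfold gateF at key
  simp only [hGdef] at key
  exact key

end K2Functional

section K2Main

variable {V : Type*} {E : Type*} [Fintype V] [DecidableEq V] [Fintype E] [DecidableEq E]
  {R : Type*} [Field R] [LinearOrder R] [IsStrictOrderedRing R]
  {arcs : E → Finset (V × V)} {s : V} {U : Finset V} {ent : Finset V} {c : V → E} {a w : V}

/-- **THEOREM (row 2′DARC at an OR-tail with two incomparable uncovered entries — head-blind).**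
`OrTailK arcs s U ent c a` with `ent = {r₁, r₂}` (`hr₁, hr₂, hent`) and SURE tail coins
(`hsure`), `SameEnds`, the cluster law of `U` log-supermodular (`hν`), ANY two markers
`m₁, m₂ ∈ U` (no covering hypothesis), the head BLIND to everything but the entry trace
(`hblind`: the avoidance probability of `W ∪ X` equals that of `(W ∩ ent) ∪ X` for `X ⊆ {a, w}`),
positive probability that nothing in `ent ∪ {a, w}` reaches `t` (`hpos`), `t, w ∉ U ∪ {a, s}` ⟹
`Φ_D({s ↛ t in D + (a → w)}) ≥ 0` for the markers `m₁, m₂` at every head, every probability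
vector. -/
theorem darc_of_orTailK2HeadBlind (pr : E → R) (hp : IsProbVec pr) (hS : SameEnds arcs)
    (h : OrTailK arcs s U ent c a) {r₁ r₂ m₁ m₂ : V} (hm₁ : m₁ ∈ U) (hm₂ : m₂ ∈ U)
    (hr₁ : r₁ ∈ ent) (hr₂ : r₂ ∈ ent) (hent : ∀ r ∈ ent, r = r₁ ∨ r = r₂)
    (hsure : ∀ r ∈ ent, pr (c r) = 1)
    (hν : ∀ W W', W ⊆ U → W' ⊆ U →
      prob pr (coreLevel arcs s U W) * prob pr (coreLevel arcs s U W') ≤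
        prob pr (coreLevel arcs s U (W ∩ W')) * prob pr (coreLevel arcs s U (W ∪ W')))
    {t : V} (htC : t ∉ insert a U) (hts : t ≠ s) (hws : w ≠ s) (hwC : w ∉ insert a U)
    (hblind : ∀ W ⊆ U, ∀ X ⊆ ({a, w} : Finset V),
      prob pr (coreAvoidEvent arcs s t (insert a U) (W ∪ X)) =
        prob pr (coreAvoidEvent arcs s t (insert a U) (W ∩ ent ∪ X)))
    (hpos : 0 < prob pr (coreAvoidEvent arcs s t (insert a U) (ent ∪ {a, w}))) :
    DARC pr arcs s {t} m₁ m₂ a w := by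
  have hC := h.closedInCoreU
  have hm₁a : m₁ ≠ a := fun e => h.a_notin (e ▸ hm₁)
  have hm₂a : m₂ ≠ a := fun e => h.a_notin (e ▸ hm₂)
  have hm₁C : m₁ ∈ insert a U := Finset.mem_insert_of_mem hm₁
  have hm₂C : m₂ ∈ insert a U := Finset.mem_insert_of_mem hm₂
  have haC : a ∈ insert a U := Finset.mem_insert_self _ _
  have hw_ent : w ∉ ent := fun hwe => hwC (Finset.mem_insert_of_mem (h.ent_sub hwe))
  have haw : a ≠ w := fun e => hwC (e ▸ Finset.mem_insert_self _ _)
  unfold DARC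
  rw [hC.phiC_gate_eq pr hS htC hts hm₁C hm₂C haC hws hwC]
  have hm1 : ∀ W : Finset V, (fun _ : Finset V => (1 : R)) (insert a W) = (fun _ => (1 : R)) W :=
    fun _ => rfl
  have hmp : ∀ W : Finset V, (fun W : Finset V => if m₁ ∈ W then (1 : R) else 0) (insert a W) =
      (fun W : Finset V => if m₁ ∈ W then (1 : R) else 0) W := by
    intro W; simp only [Finset.mem_insert, hm₁a, false_or]
  have hmq : ∀ W : Finset V, (fun W : Finset V => if m₂ ∈ W then (1 : R) else 0) (insert a W) =
      (fun W : Finset V => if m₂ ∈ W then (1 : R) else 0) W := by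
    intro W; simp only [Finset.mem_insert, hm₂a, false_or]
  have hmpq : ∀ W : Finset V,
      (fun W : Finset V => (if m₁ ∈ W then (1 : R) else 0) * (if m₂ ∈ W then (1 : R) else 0))
        (insert a W) =
      (fun W : Finset V => (if m₁ ∈ W then (1 : R) else 0) * (if m₂ ∈ W then (1 : R) else 0)) W := by
    intro W; simp only [Finset.mem_insert, hm₁a, hm₂a, false_or]
  have eΛ := h.sum_R_eq pr t (fun _ => (1 : R)) hm1
  have eFa := h.sum_R_eq pr t (fun W => if m₁ ∈ W then (1 : R) else 0) hmp
  have eFb := h.sum_R_eq pr t (fun W => if m₂ ∈ W then (1 : R) else 0) hmq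
  have eM := h.sum_G_eq (w := w) pr t (fun _ => (1 : R)) hm1
  have eX := h.sum_G_eq (w := w) pr t (fun W => if m₁ ∈ W then (1 : R) else 0) hmp
  have eY := h.sum_G_eq (w := w) pr t (fun W => if m₂ ∈ W then (1 : R) else 0) hmq
  have eXY := h.sum_G_eq (w := w) pr t
    (fun W => (if m₁ ∈ W then (1 : R) else 0) * (if m₂ ∈ W then (1 : R) else 0)) hmpq
  simp only [mul_one] at eΛ eM
  rw [eΛ, eFa, eFb, eM, eX, eY, eXY]
  obtain ⟨hA0, hAmono, hAlsm⟩ := OrTailU.head_props (U := U) (a := a) pr hp hS t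
  exact orTailK2HeadBlind_functional_nonneg U (fun W => prob pr (coreLevel arcs s U W))
    (fun X => prob pr (coreAvoidEvent arcs s t (insert a U) X)) pr ent c r₁ r₂ m₁ m₂ a w
    hp.nonneg hp.le_one hsure hr₁ hr₂ hent hw_ent haw (fun W => prob_nonneg hp _)
    (fun s' hs' t' ht' => hν s' t' hs' ht') hA0 hAlsm hAmono hblind hpos

end K2Main

end Summit.Ventures.PercRepro2.Coin
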